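import Summits.BirchSwinnertonDyer.BirchSwinnertonDyer.Theorems.ByReductionTypeAtTwoSupersingularThetaHabitatKatoBothSides
import HarnessLib

/-!
# Crux `SupersingularRankZeroAtTwo` (item stmt-BirchSwinnertonDyer-19097) ON THE THETA HABITAT from 19097's OWN two algebraic stubs
# READ AT BOTH CURVES — (2′) the signed `Γ`-Euler characteristic at `2` and (4)ʳᵃᵗ the rational Coleman–Kato package at `2`,
# at `E` AND at its rank-`0` CM partner `A` — plus `μ⁺(A) = 0`, TP2's transport K1, Burungale–Flach and PUB
# (seat `bsd-2adic-ss-1x` GEN 3, WIDTH-LEVER second prover lane on 19097; theta / CM-partner road)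

HONEST FRAMING (cells `bsd-2adic` and `bsd-wall`; HUMAN RULINGS D-0036/D-0054/D-0074): THEOREMS ONLY — no definition, no named
fact, no instance, no `sorry`; nothing about any curve is asserted beyond the displayed binders; closes no item; BSD is NOT proved
by any of this. PARTITION (D-0054): X5@2 good-ss, `a₂ = 0` THETA-HABITAT sub-row (19/208 r0 classes) × `p = 2` — types-the-object-of;
bears_on: K4-leaf crux 19097 · TP2 K1 20333 (by name) · K2r0 20312 / K3 20308 / K4 20309 (produced, not assumed).

WHAT (the symmetric form of `ThetaPartnerXRoute.thetaHabitat_of_signedTransport_of_katoBothSides`, p549774): there the CM side carried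
THREE ∀-clauses (T2_A) torsion, (K4c_A) Kim's control term, (4)ʳᵃᵗ_A; here (T2_A) and (K4c_A) are both DERIVED from ONE clause —
19097's stub (2′) `stub_zeroSignedEulerChar` with its prefix `¬ W.HasCM → W.analyticRank = 0` replaced by `A.HasCM → A.analyticRank = 0`
— exactly as lane A derives Kobayashi's torsion and Kim's value at `E` from (2′) (`signedTorsion_two_of_eulerChar`,
`signedKim_two_of_eulerChar`, p-ids of `…SupersingularLineEulerChar`): `Sel_{2^∞}(A/ℚ)` is finite in analytic rank `0` by GZK
(`finite_selmerGroupPInfty_of_analyticRank_eq_zero`), so (2′)_A gives `Sel⁺(A/ℚ_∞)^γ` finite at every cyclotomic top-generator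
pair, whence torsion (`SignedSelmerDualData.isTorsion_of_finite_endInvariants`, Greenberg Thm. 1.4 shape) and Kim's value (H4
`exists_constantCoeff_eq_unit_mul_of_signedEulerChar`, p526623). RESULT:
* `torsion_of_signedEulerChar_at`, `kimTerm_of_signedEulerChar_at` — per curve of analytic rank `0` (CM or not);
* `thetaHabitat_of_signedTransport_of_stubsBothSides` — **`WAllNonCMAtTwoThetaHabitat` ⟸ PUB {(1) `hPub`, (1′) `hKatoPub`, `hBF`,
  `h2`} + 19097's stubs (2′) and (4)ʳᵃᵗ READ AT `E` (non-CM prefix, (2′) VERBATIM) AND READ AT `A` (CM prefix) + (μ_A) `μ⁺(A) = 0` +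
  TP2's K1 BY NAME.** Nothing else: no stub (3), no (E_A), no (4′), no `TwoAdicSurjective`, no analytic `μ`.
* `bsdp_two_of_cmPartner_of_stubsBothSides_at` — per pair `(E, A, e)`, binders AT the two curves only (display shape).
So on the habitat the crux reads: «the SAME two algebraic statements (Kobayashi 1.2 / Kim 3.15 at `2`; Kato 12.4–12.5 (3) + Coleman
at `2`) for the curve and for its CM partner, one `μ`-clause, and the transport K1» — Burungale–Flach's BSD₂(A) being the only
place where the CM structure is used.

References: [Kobayashi2003] Thm. 1.2, Thm. 4.1 (p. 8), §7; [BDKim2013] Thm. 1.1, Cor. 3.15; [Kato2004Asterisque] Thm. 12.4–12.5 (3),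
§15 (15.18); [GreenbergLNM1716] Thm. 1.4, §4 Lemma 4.2; [BurungaleFlach2024] Thm. 1.1 / Cor. 2; [GreenbergVatsal2000] Thm. (1.4);
[AbbesUllmo1996] Thm. A; [Miller2011LMS] Def. 1.1.
-/

set_option autoImplicit false
-- the Theorems namespace of this sub repeats the summit name by design (D-0017 nested layout)
set_option linter.dupNamespace false

noncomputable section

open scoped Classical MatrixGroups ModularForm

open CongruenceSubgroup WeierstrassCurve Literature.NumberTheory.EllipticCurves
  Literature.NumberTheory.EllipticCurves.ModularForms Literature.NumberTheory.EllipticCurves.Sprung2017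
  Literature.NumberTheory.EllipticCurves.Rank1Residual Literature.NumberTheory.EllipticCurves.Rank1Residual.Typed
  Literature.NumberTheory.EllipticCurves.Kobayashi2003 Literature.NumberTheory.EllipticCurves.IwasawaDual
  ZpExtension Summit.BirchSwinnertonDyer.Rank1Residual Summit.BirchSwinnertonDyer.Rank1Residual.Supersingular
  Summit.BirchSwinnertonDyer.Rank1Residual.X5.O1 Summit.BirchSwinnertonDyer.BirchSwinnertonDyer.Theses.ThetaPartnerAtTwo

namespace Summit.BirchSwinnertonDyer.BirchSwinnertonDyer.Theorems

namespace ThetaPartnerXRoute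

/-! ## §1 Per curve of analytic rank `0`: (2′) ⇒ torsion and Kim's control term -/

section PerCurve

variable (W : WeierstrassCurve ℚ) [W.IsElliptic]

/-- **(2′) at a curve of analytic rank `0` ⇒ `X⁺` is `Λ`-torsion at every cyclotomic top-generator pair** (CM or not): GZK makes
`Sel_{2^∞}(W/ℚ)` finite, (2′) then makes `Sel⁺(W/ℚ_∞)^γ` finite, and Greenberg's Thm. 1.4 mechanism
(`SignedSelmerDualData.isTorsion_of_finite_endInvariants`) gives torsion. [cite: GreenbergLNM1716, Thm. 1.4 (p. 61) and §4 Lemma 4.2]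
[cite: Kobayashi2003, Thm. 1.2] [cite: BDKim2013, Thm. 1.1] -/
theorem torsion_of_signedEulerChar_at (hGZK : rank_eq_analyticRank_of_analyticRank_le_one) (hr : W.analyticRank = 0)
    (hEC : ∀ (κ : ZpExtension ℚ 2) (γ : Field.absoluteGaloisGroup ℚ),
          κ.IsCyclotomic → κ.IsTopGenerator γ → Finite (W.selmerGroupPInfty 2) →
          Finite (endInvariants (conjSignedSelmerInfty W κ 1 γ - 1)) ∧
            ∃ u : ℤ_[2]ˣ, (Nat.card (endInvariants (conjSignedSelmerInfty W κ 1 γ - 1)) : ℚ_[2]) =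
              ((u : ℤ_[2]) : ℚ_[2]) * ((2 : ℕ) : ℚ_[2]) ^ (padicValNat 2 W.tamagawaProduct) *
                (Nat.card (W.selmerGroupPInfty 2) : ℚ_[2]) *
                  (Nat.card (EndCoinvariants (conjSignedSelmerInfty W κ 1 γ - 1)) : ℚ_[2])) :
    ∀ (κ : ZpExtension ℚ 2) (γ : Field.absoluteGaloisGroup ℚ), κ.IsCyclotomic → κ.IsTopGenerator γ →
      ∀ D : SignedSelmerDualData W κ γ 1, Module.IsTorsion (IwasawaAlgebra 2) D.X := by
  intro κ γ hκ hγ D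
  have hSel : Finite (W.selmerGroupPInfty 2) := finite_selmerGroupPInfty_of_analyticRank_eq_zero hGZK W 2 hr
  exact D.isTorsion_of_finite_endInvariants hγ (hEC κ γ hκ hγ hSel).1

/-- **(2′) at a curve ⇒ B. D. Kim's control term at `2` there** (CM or not): H4 `exists_constantCoeff_eq_unit_mul_of_signedEulerChar`
(Greenberg's Lemma 4.2 on the dual pair; `#S_Γ ≠ 0` cancels). [cite: BDKim2013, Cor. 3.15 (p. 199)]
[cite: GreenbergLNM1716, §4 Lemma 4.2 (p. 102)] -/
theorem kimTerm_of_signedEulerChar_at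
    (hEC : ∀ (κ : ZpExtension ℚ 2) (γ : Field.absoluteGaloisGroup ℚ),
          κ.IsCyclotomic → κ.IsTopGenerator γ → Finite (W.selmerGroupPInfty 2) →
          Finite (endInvariants (conjSignedSelmerInfty W κ 1 γ - 1)) ∧
            ∃ u : ℤ_[2]ˣ, (Nat.card (endInvariants (conjSignedSelmerInfty W κ 1 γ - 1)) : ℚ_[2]) =
              ((u : ℤ_[2]) : ℚ_[2]) * ((2 : ℕ) : ℚ_[2]) ^ (padicValNat 2 W.tamagawaProduct) *
                (Nat.card (W.selmerGroupPInfty 2) : ℚ_[2]) *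
                  (Nat.card (EndCoinvariants (conjSignedSelmerInfty W κ 1 γ - 1)) : ℚ_[2])) :
    ∀ (κ : ZpExtension ℚ 2) (γ : Field.absoluteGaloisGroup ℚ), κ.IsCyclotomic → κ.IsTopGenerator γ →
      ∀ (D : SignedSelmerDualData W κ γ 1) [Module.Finite (IwasawaAlgebra 2) D.X],
        Module.IsTorsion (IwasawaAlgebra 2) D.X →
      ∀ g : IwasawaAlgebra 2, D.charIdeal = Ideal.span {g} → Finite (W.selmerGroupPInfty 2) →
        ∃ u : ℤ_[2]ˣ, ((PowerSeries.constantCoeff g : ℤ_[2]) : ℚ_[2]) =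
          ((u : ℤ_[2]) : ℚ_[2]) * ((2 : ℕ) : ℚ_[2]) ^ (padicValNat 2 W.tamagawaProduct) *
            (Nat.card (W.selmerGroupPInfty 2) : ℚ_[2]) := by
  intro κ γ hκ hγ D _ _ g hg hSel
  obtain ⟨hfin, u, hu⟩ := hEC κ γ hκ hγ hSel
  obtain ⟨u', hu'⟩ := exists_constantCoeff_eq_unit_mul_of_signedEulerChar W hγ D hg hfin
    (c := ((2 : ℕ) : ℚ_[2]) ^ (padicValNat 2 W.tamagawaProduct) * (Nat.card (W.selmerGroupPInfty 2) : ℚ_[2]))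
    ⟨u, by rw [hu]; ring⟩
  exact ⟨u', by rw [hu']; ring⟩

end PerCurve

/-! ## §2 The habitat from 19097's stubs (2′), (4)ʳᵃᵗ read at BOTH curves + `μ⁺(A) = 0` + K1 + PUB -/

/-- **Crux 19097 ON THE THETA HABITAT from its OWN stubs read at both curves.** Binders: PUB (1) `hPub` (modularity ∧ GZK), (1′)
`hKatoPub` (Kato 12.4 (2) ∧ 12.4 (1)∘(17.13.1)), `hBF` (Burungale–Flach), `h2` (the `p = 2` period fact); 19097's (2′)
`stub_zeroSignedEulerChar` VERBATIM (`hEC`) and READ AT the rank-`0` CM partners (`hECA`: same body, CM prefix); 19097's (4)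
`stub_zeroColemanKato` minus its guarded `𝔭 ∋ 2` clause at `E` (`hCK`) and READ AT the partners (`hCKA`); (μ_A) `hmuA`
`μ⁺(A) = 0`; TP2's K1 `hT`. Via `thetaHabitat_of_signedTransport_of_katoBothSides` (p549774) with (T2_A), (K4c_A) from §1.
[cite: BurungaleFlach2024, Thm. 1.1 and Cor. 2] [cite: Kobayashi2003, Thm. 1.2, Thm. 4.1 and §7] [cite: BDKim2013, Cor. 3.15]
[cite: Kato2004Asterisque, Thm. 12.4–12.5 (3), §15] [cite: GreenbergVatsal2000, Thm. (1.4)] [cite: Miller2011LMS, Def. 1.1] -/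
theorem thetaHabitat_of_signedTransport_of_stubsBothSides
    (hPub : nonempty_modularParametrizationData ∧ rank_eq_analyticRank_of_analyticRank_le_one)
    (hKatoPub : Kato2004.thm12_4 ∧ Kato2004_fineSelmerDual_isTorsion)
    (hBF : bsdTriple_of_hasCM_of_L_one_ne_zero) (h2 : realPeriodRat_eq_unit_mul_plusPeriod_two)
    (hEC : ∀ (W : WeierstrassCurve ℚ) [W.IsElliptic] [W.IsGloballyMinimal],
      ¬ W.HasCM → W.analyticRank = 0 → GoodSS W 2 → W.frobeniusTrace 2 = 0 →
      ∀ (κ : ZpExtension ℚ 2) (γ : Field.absoluteGaloisGroup ℚ),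
          κ.IsCyclotomic → κ.IsTopGenerator γ → Finite (W.selmerGroupPInfty 2) →
          Finite (endInvariants (conjSignedSelmerInfty W κ 1 γ - 1)) ∧
            ∃ u : ℤ_[2]ˣ, (Nat.card (endInvariants (conjSignedSelmerInfty W κ 1 γ - 1)) : ℚ_[2]) =
              ((u : ℤ_[2]) : ℚ_[2]) * ((2 : ℕ) : ℚ_[2]) ^ (padicValNat 2 W.tamagawaProduct) *
                (Nat.card (W.selmerGroupPInfty 2) : ℚ_[2]) *
                  (Nat.card (EndCoinvariants (conjSignedSelmerInfty W κ 1 γ - 1)) : ℚ_[2]))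
    (hCK : ∀ (W : WeierstrassCurve ℚ) [W.IsElliptic] [W.IsGloballyMinimal],
      ¬ W.HasCM → W.analyticRank = 0 → GoodSS W 2 → W.frobeniusTrace 2 = 0 →
      ∀ (κ : ZpExtension ℚ 2) (γ : Field.absoluteGaloisGroup ℚ),
        κ.IsCyclotomic → κ.IsTopGenerator γ → IsCyclotomicVariable 2 γ →
        ∀ [NeZero (W.conductorNorm ℤ)] (f : CuspForm (Gamma0 (W.conductorNorm ℤ)) 2),
          IsNewformOf W f → ∀ (ϖ : ℚ), (ϖ : ℝ) * W.realPeriodRat = plusPeriod f →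
        ∀ (Lplus Lminus : IwasawaAlgebra 2), IsPollackPair f 2 Lplus Lminus →
        ∀ (D : SignedSelmerDualData W κ γ 1) [ContinuousSMul ℤ_[2] (W.tateModule 2)],
          ∃ (I : Kato2004.IwasawaH1Data W 2 κ γ) (Y : W.FineSelmerDualData κ γ)
            (P : Submodule (IwasawaAlgebra 2) (IwasawaAlgebra 2))
            (loc : I.H →ₗ[IwasawaAlgebra 2] P) (toX : P →ₗ[IwasawaAlgebra 2] D.X)
            (δ : D.X →ₗ[IwasawaAlgebra 2] Y.X) (Z : Submodule (IwasawaAlgebra 2) I.H)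
            (G : IwasawaAlgebra 2),
            Function.Exact loc toX ∧ Function.Exact toX δ ∧
            G ∈ Submodule.map (P.subtype ∘ₗ loc) Z ∧
            iwasawaToPowerSeries 2 G =
              PowerSeries.C (ϖ : ℚ_[2]) * iwasawaToPowerSeries 2 (kobayashiL 1 Lplus Lminus) ∧
            (∀ 𝔭 : PrimeSpectrum (IwasawaAlgebra 2), 𝔭.asIdeal.height = 1 →
              PowerSeries.C (2 : ℤ_[2]) ∉ 𝔭.asIdeal →
              Literature.NumberTheory.EllipticCurves.Module.lengthAt (IwasawaAlgebra 2) Y.X 𝔭 ≤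
                Literature.NumberTheory.EllipticCurves.Module.lengthAt (IwasawaAlgebra 2) (I.H ⧸ Z) 𝔭))
    (hECA : ∀ (A : WeierstrassCurve ℚ) [A.IsElliptic] [A.IsGloballyMinimal],
      A.HasCM → A.analyticRank = 0 → GoodSS A 2 → A.frobeniusTrace 2 = 0 →
      ∀ (κ : ZpExtension ℚ 2) (γ : Field.absoluteGaloisGroup ℚ),
          κ.IsCyclotomic → κ.IsTopGenerator γ → Finite (A.selmerGroupPInfty 2) →
          Finite (endInvariants (conjSignedSelmerInfty A κ 1 γ - 1)) ∧
            ∃ u : ℤ_[2]ˣ, (Nat.card (endInvariants (conjSignedSelmerInfty A κ 1 γ - 1)) : ℚ_[2]) =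
              ((u : ℤ_[2]) : ℚ_[2]) * ((2 : ℕ) : ℚ_[2]) ^ (padicValNat 2 A.tamagawaProduct) *
                (Nat.card (A.selmerGroupPInfty 2) : ℚ_[2]) *
                  (Nat.card (EndCoinvariants (conjSignedSelmerInfty A κ 1 γ - 1)) : ℚ_[2]))
    (hCKA : ∀ (A : WeierstrassCurve ℚ) [A.IsElliptic] [A.IsGloballyMinimal],
      A.HasCM → A.analyticRank = 0 → GoodSS A 2 → A.frobeniusTrace 2 = 0 →
      ∀ (κ : ZpExtension ℚ 2) (γ : Field.absoluteGaloisGroup ℚ),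
        κ.IsCyclotomic → κ.IsTopGenerator γ → IsCyclotomicVariable 2 γ →
        ∀ [NeZero (A.conductorNorm ℤ)] (f : CuspForm (Gamma0 (A.conductorNorm ℤ)) 2),
          IsNewformOf A f → ∀ (ϖ : ℚ), (ϖ : ℝ) * A.realPeriodRat = plusPeriod f →
        ∀ (Lplus Lminus : IwasawaAlgebra 2), IsPollackPair f 2 Lplus Lminus →
        ∀ (D : SignedSelmerDualData A κ γ 1) [ContinuousSMul ℤ_[2] (A.tateModule 2)],
          ∃ (I : Kato2004.IwasawaH1Data A 2 κ γ) (Y : A.FineSelmerDualData κ γ)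
            (P : Submodule (IwasawaAlgebra 2) (IwasawaAlgebra 2))
            (loc : I.H →ₗ[IwasawaAlgebra 2] P) (toX : P →ₗ[IwasawaAlgebra 2] D.X)
            (δ : D.X →ₗ[IwasawaAlgebra 2] Y.X) (Z : Submodule (IwasawaAlgebra 2) I.H)
            (G : IwasawaAlgebra 2),
            Function.Exact loc toX ∧ Function.Exact toX δ ∧
            G ∈ Submodule.map (P.subtype ∘ₗ loc) Z ∧
            iwasawaToPowerSeries 2 G =
              PowerSeries.C (ϖ : ℚ_[2]) * iwasawaToPowerSeries 2 (kobayashiL 1 Lplus Lminus) ∧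
            (∀ 𝔭 : PrimeSpectrum (IwasawaAlgebra 2), 𝔭.asIdeal.height = 1 →
              PowerSeries.C (2 : ℤ_[2]) ∉ 𝔭.asIdeal →
              Literature.NumberTheory.EllipticCurves.Module.lengthAt (IwasawaAlgebra 2) Y.X 𝔭 ≤
                Literature.NumberTheory.EllipticCurves.Module.lengthAt (IwasawaAlgebra 2) (I.H ⧸ Z) 𝔭))
    (hmuA : ∀ (A : WeierstrassCurve ℚ) [A.IsElliptic] [A.IsGloballyMinimal],
      A.HasCM → A.analyticRank = 0 → GoodSS A 2 → A.frobeniusTrace 2 = 0 →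
      ∀ (κ : ZpExtension ℚ 2) (γ : Field.absoluteGaloisGroup ℚ), κ.IsCyclotomic → κ.IsTopGenerator γ →
      ∀ D : SignedSelmerDualData A κ γ 1, D.mu = 0)
    (hT : SignedTransportAtTwo) :
    Summit.BirchSwinnertonDyer.WAllNonCMAtTwoThetaHabitat :=
  thetaHabitat_of_signedTransport_of_katoBothSides hPub hKatoPub hBF h2 hEC hCK
    (fun A _ _ hcm hr hss ha => torsion_of_signedEulerChar_at A hPub.2 hr (hECA A hcm hr hss ha))
    hmuA (fun A _ _ hcm hr hss ha => kimTerm_of_signedEulerChar_at A (hECA A hcm hr hss ha)) hCKA hT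

/-! ## §3 Per pair `(E, A)`: the display shape -/

/-- **BSD₂ of a habitat curve from its CM partner, from 19097's stubs (2′), (4)ʳᵃᵗ read AT `E` and AT `A`, `μ⁺(A) = 0`, K1 and PUB**
(per-pair form of §2; via `bsdp_two_of_cmPartner_of_katoBothSides_at`, p549774, with (T2), (K4c) at `A` from §1).
[cite: BurungaleFlach2024, Thm. 1.1 and Cor. 2] [cite: GreenbergVatsal2000, Thm. (1.4)] [cite: Kobayashi2003, Thm. 1.2 and Thm. 4.1]
[cite: BDKim2013, Cor. 3.15] [cite: Miller2011LMS, Def. 1.1] -/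
theorem bsdp_two_of_cmPartner_of_stubsBothSides_at (hmod : nonempty_modularParametrizationData)
    (hGZK : rank_eq_analyticRank_of_analyticRank_le_one)
    (h124 : Kato2004.thm12_4) (hX0 : Kato2004_fineSelmerDual_isTorsion)
    (hBF : bsdTriple_of_hasCM_of_L_one_ne_zero) (h2 : realPeriodRat_eq_unit_mul_plusPeriod_two)
    (hT : SignedTransportAtTwo)
    (W : WeierstrassCurve ℚ) [W.IsElliptic] [W.IsGloballyMinimal] (hcm : ¬ W.HasCM) (hr : W.analyticRank = 0)
    (hss : GoodSS W 2) (ha : W.frobeniusTrace 2 = 0)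
    (A : WeierstrassCurve ℚ) [A.IsElliptic] [A.IsGloballyMinimal] (hAcm : A.HasCM) (hAr : A.analyticRank = 0)
    (hAss : GoodSS A 2) (hAa : A.frobeniusTrace 2 = 0)
    (e : WeierstrassCurve.geomTorsion W (2 : ℤ) ≃+ WeierstrassCurve.geomTorsion A (2 : ℤ))
    (he : ∀ (σ : Field.absoluteGaloisGroup ℚ) (P : WeierstrassCurve.geomTorsion W (2 : ℤ)), e (σ • P) = σ • e P)
    (hEC : ∀ (κ : ZpExtension ℚ 2) (γ : Field.absoluteGaloisGroup ℚ),
          κ.IsCyclotomic → κ.IsTopGenerator γ → Finite (W.selmerGroupPInfty 2) →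
          Finite (endInvariants (conjSignedSelmerInfty W κ 1 γ - 1)) ∧
            ∃ u : ℤ_[2]ˣ, (Nat.card (endInvariants (conjSignedSelmerInfty W κ 1 γ - 1)) : ℚ_[2]) =
              ((u : ℤ_[2]) : ℚ_[2]) * ((2 : ℕ) : ℚ_[2]) ^ (padicValNat 2 W.tamagawaProduct) *
                (Nat.card (W.selmerGroupPInfty 2) : ℚ_[2]) *
                  (Nat.card (EndCoinvariants (conjSignedSelmerInfty W κ 1 γ - 1)) : ℚ_[2]))
    (hCK : ∀ (κ : ZpExtension ℚ 2) (γ : Field.absoluteGaloisGroup ℚ),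
        κ.IsCyclotomic → κ.IsTopGenerator γ → IsCyclotomicVariable 2 γ →
        ∀ [NeZero (W.conductorNorm ℤ)] (f : CuspForm (Gamma0 (W.conductorNorm ℤ)) 2),
          IsNewformOf W f → ∀ (ϖ : ℚ), (ϖ : ℝ) * W.realPeriodRat = plusPeriod f →
        ∀ (Lplus Lminus : IwasawaAlgebra 2), IsPollackPair f 2 Lplus Lminus →
        ∀ (D : SignedSelmerDualData W κ γ 1) [ContinuousSMul ℤ_[2] (W.tateModule 2)],
          ∃ (I : Kato2004.IwasawaH1Data W 2 κ γ) (Y : W.FineSelmerDualData κ γ)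
            (P : Submodule (IwasawaAlgebra 2) (IwasawaAlgebra 2))
            (loc : I.H →ₗ[IwasawaAlgebra 2] P) (toX : P →ₗ[IwasawaAlgebra 2] D.X)
            (δ : D.X →ₗ[IwasawaAlgebra 2] Y.X) (Z : Submodule (IwasawaAlgebra 2) I.H)
            (G : IwasawaAlgebra 2),
            Function.Exact loc toX ∧ Function.Exact toX δ ∧
            G ∈ Submodule.map (P.subtype ∘ₗ loc) Z ∧
            iwasawaToPowerSeries 2 G =
              PowerSeries.C (ϖ : ℚ_[2]) * iwasawaToPowerSeries 2 (kobayashiL 1 Lplus Lminus) ∧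
            (∀ 𝔭 : PrimeSpectrum (IwasawaAlgebra 2), 𝔭.asIdeal.height = 1 →
              PowerSeries.C (2 : ℤ_[2]) ∉ 𝔭.asIdeal →
              Literature.NumberTheory.EllipticCurves.Module.lengthAt (IwasawaAlgebra 2) Y.X 𝔭 ≤
                Literature.NumberTheory.EllipticCurves.Module.lengthAt (IwasawaAlgebra 2) (I.H ⧸ Z) 𝔭))
    (hECA : ∀ (κ : ZpExtension ℚ 2) (γ : Field.absoluteGaloisGroup ℚ),
          κ.IsCyclotomic → κ.IsTopGenerator γ → Finite (A.selmerGroupPInfty 2) →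
          Finite (endInvariants (conjSignedSelmerInfty A κ 1 γ - 1)) ∧
            ∃ u : ℤ_[2]ˣ, (Nat.card (endInvariants (conjSignedSelmerInfty A κ 1 γ - 1)) : ℚ_[2]) =
              ((u : ℤ_[2]) : ℚ_[2]) * ((2 : ℕ) : ℚ_[2]) ^ (padicValNat 2 A.tamagawaProduct) *
                (Nat.card (A.selmerGroupPInfty 2) : ℚ_[2]) *
                  (Nat.card (EndCoinvariants (conjSignedSelmerInfty A κ 1 γ - 1)) : ℚ_[2]))
    (hCKA : ∀ (κ : ZpExtension ℚ 2) (γ : Field.absoluteGaloisGroup ℚ),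
        κ.IsCyclotomic → κ.IsTopGenerator γ → IsCyclotomicVariable 2 γ →
        ∀ [NeZero (A.conductorNorm ℤ)] (f : CuspForm (Gamma0 (A.conductorNorm ℤ)) 2),
          IsNewformOf A f → ∀ (ϖ : ℚ), (ϖ : ℝ) * A.realPeriodRat = plusPeriod f →
        ∀ (Lplus Lminus : IwasawaAlgebra 2), IsPollackPair f 2 Lplus Lminus →
        ∀ (D : SignedSelmerDualData A κ γ 1) [ContinuousSMul ℤ_[2] (A.tateModule 2)],
          ∃ (I : Kato2004.IwasawaH1Data A 2 κ γ) (Y : A.FineSelmerDualData κ γ)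
            (P : Submodule (IwasawaAlgebra 2) (IwasawaAlgebra 2))
            (loc : I.H →ₗ[IwasawaAlgebra 2] P) (toX : P →ₗ[IwasawaAlgebra 2] D.X)
            (δ : D.X →ₗ[IwasawaAlgebra 2] Y.X) (Z : Submodule (IwasawaAlgebra 2) I.H)
            (G : IwasawaAlgebra 2),
            Function.Exact loc toX ∧ Function.Exact toX δ ∧
            G ∈ Submodule.map (P.subtype ∘ₗ loc) Z ∧
            iwasawaToPowerSeries 2 G =
              PowerSeries.C (ϖ : ℚ_[2]) * iwasawaToPowerSeries 2 (kobayashiL 1 Lplus Lminus) ∧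
            (∀ 𝔭 : PrimeSpectrum (IwasawaAlgebra 2), 𝔭.asIdeal.height = 1 →
              PowerSeries.C (2 : ℤ_[2]) ∉ 𝔭.asIdeal →
              Literature.NumberTheory.EllipticCurves.Module.lengthAt (IwasawaAlgebra 2) Y.X 𝔭 ≤
                Literature.NumberTheory.EllipticCurves.Module.lengthAt (IwasawaAlgebra 2) (I.H ⧸ Z) 𝔭))
    (hmuA : ∀ (κ : ZpExtension ℚ 2) (γ : Field.absoluteGaloisGroup ℚ), κ.IsCyclotomic → κ.IsTopGenerator γ →
      ∀ D : SignedSelmerDualData A κ γ 1, D.mu = 0) :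
    BSDp W 2 :=
  bsdp_two_of_cmPartner_of_katoBothSides_at hmod hGZK h124 hX0 hBF h2 hT W hcm hr hss ha A hAcm hAr hAss hAa e he hEC hCK
    (torsion_of_signedEulerChar_at A hGZK hAr hECA) hmuA (kimTerm_of_signedEulerChar_at A hECA) hCKA

end ThetaPartnerXRoute

end Summit.BirchSwinnertonDyer.BirchSwinnertonDyer.Theorems

end
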